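import Summits.ResolutionOfSingularities.ResolutionOfSingularities.Theorems.EquisingularLiftEquisingularLiftWittRing
import Summits.ResolutionOfSingularities.ResolutionOfSingularities.Theorems.EquisingularLiftEquisingularLiftProjectiveAmbientSmoothProper
import Summits.ResolutionOfSingularities.ResolutionOfSingularities.Theorems.EquisingularLiftEquisingularLiftProjectiveAmbientFibre
import Literature.AlgebraicGeometry.Resolution.ProjectiveSpaceRegular
import HarnessLib

/-!
# `EquisingularLift` (stmt-ResolutionOfSingularities-15660), line `Sketch` v9 — helper for the research stub
# `stub_horizResolution_three`: THE STAGE-0 DATA (`O = 𝕎(k)`, `P = ℙⁿ_O`, `Y ≅ H`, integral special fibre)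

[OURS · L1 W4.5b] Helper (not a registered stub) for the crux `EquisingularLift`; NOT a statement of any manuscript.

The registered `n = 3` research stub `stub_horizResolution_three` asks for a DVR `O` of characteristic `0`, a smooth
proper `q : P → Spec O` whose scheme-theoretic special fibre `P ×_{Spec O} Spec κ` is INTEGRAL, a closed `Y` inside the
special fibre with `V(Y)_red ≅ H`, and then a "HorizChain" resolving `Y`. This file packages the stage-0 data once and
for all (any `n`): `O := 𝕎(k)` (complete, residue field algebraically closed, `stub_wittRing` p158907),
`P := ℙⁿ_O` (smooth and proper, `stub_projectiveAmbientSmoothProper` p159079), `Y :=` the image of `H` under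
`ℙⁿ_k = ℙⁿ_O ×_O k ↪ ℙⁿ_O` (`stub_projectiveAmbientFibre` p160143), and the NEW conjunct: the scheme-theoretic special
fibre `ℙⁿ_O ×_{Spec O} Spec κ` is integral — it is `ℙⁿ_κ` by the cartesian square
`ProjectiveAmbientFibre.isPullback_projMap` (Liu 2002, Prop. 3.1.9) for the surjection `O → κ`, and `ℙⁿ_κ` is integral
(`isIntegral_projectiveSpace`). Also recorded: `Y` is irreducible (it has the generic point of `H`).

* `isIntegral_specialFibre_projectiveSpace` — `ℙⁿ_O ×_{Spec O} Spec κ` is integral for any local ring `O`;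
* `horizResolution_base` — the packaged stage-0 data for `stub_horizResolution_three` / any HorizChain strategy.
-/

set_option linter.dupNamespace false -- mandated namespace `Summit.<Summit>.<Problem>` of this single-conjunct summit

noncomputable section

open CategoryTheory CategoryTheory.Limits AlgebraicGeometry TopologicalSpace
open MvPolynomial
open Literature.AlgebraicGeometry.Resolution
open AlgebraicGeometry.Scheme.IdealSheafData

attribute [local instance] MvPolynomial.gradedAlgebra
attribute [local instance] Literature.AlgebraicGeometry.Motives.ProjBaseChange.algebraBase

namespace Summit.ResolutionOfSingularities.ResolutionOfSingularities.Cruxes.EquisingularLift.StrataSplit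

/-- **The scheme-theoretic special fibre of `ℙⁿ_O → Spec O` is integral** (`O` local with residue field `κ`): it is
`ℙⁿ_κ` (`ProjectiveAmbientFibre.isPullback_projMap`, Liu Prop. 3.1.9, for the surjection `O → κ`), which is integral.
[cite: Liu2002, Prop. 3.1.9 and Ex. 3.1.10] -/
theorem isIntegral_specialFibre_projectiveSpace (O : Type) [CommRing O] [IsLocalRing O] (n : ℕ) :
    IsIntegral (pullback
      (Proj.toSpecZero (homogeneousSubmodule (Fin (n + 1)) O) ≫
        Spec.map (CommRingCat.ofHom (algebraMap O ((homogeneousSubmodule (Fin (n + 1)) O) 0))))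
      (Spec.map (CommRingCat.ofHom (IsLocalRing.residue O)))) := by
  let φ : homogeneousSubmodule (Fin (n + 1)) O →+*ᵍ homogeneousSubmodule (Fin (n + 1)) (IsLocalRing.ResidueField O) :=
    ⟨MvPolynomial.map (IsLocalRing.residue O), fun h ↦ h.map _⟩
  have hφ : ∀ s, φ s = MvPolynomial.map (IsLocalRing.residue O) s := fun _ ↦ rfl
  have hπ : Function.Surjective (IsLocalRing.residue O) := IsLocalRing.residue_surjective
  have hφ' := ProjectiveAmbientFibre.irrelevant_le_map_gradedMap (IsLocalRing.residue O) φ hφ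
  have hP := ProjectiveAmbientFibre.isPullback_projMap (IsLocalRing.residue O) φ hφ hπ hφ'
  haveI : IsIntegral (Proj (homogeneousSubmodule (Fin (n + 1)) (IsLocalRing.ResidueField O))) :=
    isIntegral_projectiveSpace n (IsLocalRing.ResidueField O)
  exact IsIntegral.of_isIso hP.isoPullback.hom

/-- **Stage-0 data for a HorizChain strategy** (helper for the registered research stub `stub_horizResolution_three`,
valid for every `n`): for an integral closed `H ⊆ ℙⁿ_k` over an algebraically closed field `k` of characteristic `p`
there are a COMPLETE discrete valuation ring `O` of characteristic `0` with algebraically closed residue field (the Witt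
vectors `𝕎(k)`), a smooth proper `q : P → Spec O` (`P = ℙⁿ_O`) with INTEGRAL scheme-theoretic special fibre, and an
irreducible closed `Y ⊆ P` inside the special fibre whose reduced induced closed subscheme is isomorphic to `H`.
[OURS · L1 W4.5b] [folklore] -/
theorem horizResolution_base : ∀ p : ℕ, p.Prime → ∀ (k : Type) [Field k] [CharP k p] [IsAlgClosed k] (n : ℕ)
    (H : AlgebraicGeometry.Scheme.{0}) (ι : H ⟶ (Literature.AlgebraicGeometry.Motives.projectiveSpace n k).left),
    AlgebraicGeometry.IsClosedImmersion ι → AlgebraicGeometry.IsIntegral H →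
    ∃ (O : Type) (_ : CommRing O) (_ : IsDomain O) (_ : IsDiscreteValuationRing O) (_ : CharZero O)
      (_ : IsAdicComplete (IsLocalRing.maximalIdeal O) O) (_ : IsAlgClosed (IsLocalRing.ResidueField O))
      (P : AlgebraicGeometry.Scheme.{0}) (q : P ⟶ AlgebraicGeometry.Spec (.of O)) (Y : TopologicalSpace.Closeds P),
      AlgebraicGeometry.Smooth q ∧ AlgebraicGeometry.IsProper q ∧
      (Y : Set P) ⊆ q ⁻¹' {IsLocalRing.closedPoint O} ∧
      Nonempty ((AlgebraicGeometry.Scheme.IdealSheafData.vanishingIdeal Y).subscheme ≅ H) ∧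
      AlgebraicGeometry.IsIntegral (CategoryTheory.Limits.pullback q
        (AlgebraicGeometry.Spec.map (CommRingCat.ofHom (IsLocalRing.residue O)))) ∧
      IsIrreducible (Y : Set P) := by
  intro p hp k _ _ _ n H ι hι hH
  obtain ⟨O, i1, i2, i3, i4, i5, i6, π, hπ⟩ := stub_wittRing p hp k
  obtain ⟨hq, hqp⟩ := stub_projectiveAmbientSmoothProper O n
  obtain ⟨Y, hY, ⟨e⟩, -⟩ := stub_projectiveAmbientFibre O k π hπ n H ι hι hH
  refine ⟨O, i1, i2, i3, i4, i5, i6, _, _, Y, hq, hqp, hY, ⟨e⟩, isIntegral_specialFibre_projectiveSpace O n, ?_⟩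
  -- `Y` is irreducible: it is the closure of the image of the generic point of `H`
  haveI := hH
  let ι₀ : H ⟶ Proj (homogeneousSubmodule (Fin (n + 1)) O) :=
    e.inv ≫ (Scheme.IdealSheafData.vanishingIdeal Y).subschemeι
  have hrange : Set.range ι₀ = (Y : Set _) := by
    rw [← Scheme.IdealSheafData.coe_support_vanishingIdeal Y, ← Scheme.IdealSheafData.range_subschemeι]
    ext x
    constructor
    · rintro ⟨h, rfl⟩
      exact ⟨e.inv h, (Scheme.Hom.comp_apply _ _ h).symm⟩
    · rintro ⟨y, rfl⟩
      obtain ⟨h, rfl⟩ := e.inv.surjective y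
      exact ⟨h, Scheme.Hom.comp_apply _ _ h⟩
  have hgen : IsGenericPoint (ι₀ (genericPoint H)) (Y : Set _) := by
    have h := (genericPoint_spec H).image ι₀.continuous
    rwa [Set.image_univ, ι₀.isClosedEmbedding.isClosed_range.closure_eq, hrange] at h
  have h := (isIrreducible_singleton (x := ι₀ (genericPoint H))).closure
  rwa [hgen] at h

end Summit.ResolutionOfSingularities.ResolutionOfSingularities.Cruxes.EquisingularLift.StrataSplit

end
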